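import Summits.QuantumFields.YangMills.Theses.InfraredLiouville

/-!
# Birth skeleton (BC3) for crux `ThinEdgeExclusion` (stmt-QuantumFields-9706) — `Lines/birth.lean`

Registrar: `planner-skel-stmt-QuantumFields-9706-0` (skeleton-register one-shot; route
`route-QuantumFields-InfraredLiouville`, re-audit bin REPAIRABLE), 2026-08-17.

Crux (route file `Theses/InfraredLiouville.lean`, decl
`Summit.QuantumFields.YangMills.Theses.InfraredLiouville.ThinEdgeExclusion`): for every compact `G`,
`r : LatticeRep G`, `β₀`: IF at every `β ≥ β₀` every connected torus time-correlation
`latticeConnectedCorr r.ρ β (2S+1) A B n` of gauge-invariant local observables decays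
super-polynomially in INFINITE-VOLUME FORM (`∀ p ∃ C ∀ n ∃ S₀ ∀ S ≥ S₀, nᵖ·|…| ≤ C`), THEN
`∃ β₁ (m : ℝ → ℝ)`, `m β > 0` on `[β₁, ∞)`, and per pair `(A, B)` constants `C, S₀` UNIFORM IN `β ≥ β₁` with
`|…| ≤ C·e^{−m(β) n}` for all `S ≥ S₀`, `n ≤ S` (volume-uniform, one rate: the shape `HasLatticeMassGap` needs).

## The cut: the two upgrades the retriage named, one stub each

Both retriage passes on this item (2026-08-15) locate its live content in exactly TWO upgrades with no
gauge-theory theorem behind either: (E) THIN-EDGE EXCLUSION proper — super-polynomial ⇒ exponential with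
ONE rate for all observables (no super-polynomially thin spectral edge of the transfer matrix), and
(F) the FINITE-SIZE / UNIFORMITY upgrade — infinite-volume-form decay (`∀ n ∃ S₀(n) ∀ S ≥ S₀(n)`, which
never speaks about separations comparable to the period) ⇒ decay for ALL `n ≤ S` on every large torus,
with prefactor and threshold uniform in `β` (femto-torus `S ≲ ξ(β)` corrections below norm-type
prefactors; absorbable into `m(β)` only once a volume-uniform statement exists).  The route header's
two-layer plan foresees the same split (`SpectralEdgeRegularity → FiniteSizeBootstrap → ThinEdgeExclusion`).
This skeleton cuts BETWEEN (E) and (F) at the intermediate statement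
"exponential clustering at `β` in infinite-volume form with one rate `m(β) > 0`":

* `stub_edgeRegularity` — (E), POINTWISE in `β`: super-polynomial decay of all connected torus
  time-correlations at `β` (infinite-volume form) ⇒ `∃ m > 0, ∀ A B, ∃ C, ∀ n, ∃ S₀, ∀ S ≥ S₀,
  |latticeConnectedCorr r.ρ β (2S+1) A B n| ≤ C e^{−m n}`.  Why it might fail: for ONE reflection-positive
  diagonal correlator `∫ λⁿ dμ(λ)` a super-polynomially thin edge `μ((1−ε,1]) ~ e^{−1/ε}` gives `e^{−2√n}`
  (super-polynomial, gapless); the stub bets that the FAMILY of all local gauge-invariant observables of a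
  Wilson theory cannot realise this (log-convexity `c(n+1)² ≤ c(n)c(n+2)` of RP diagonal correlators,
  tree `TransferDecayUpgrade`, makes `c(n+1)/c(n)` monotone, so the alternative to a gap is a ratio
  creeping to `1` coherently across all observables).  Size L.  Holds trivially where the hypothesis
  fails (U(1) Coulomb phase, critical points) and provably at strong coupling
  (`osterwalder_seiler_torusClustering_uniform`).
* `stub_finiteSizeBootstrap` — (F): IF at every `β ≥ β₀` the theory clusters exponentially in
  infinite-volume form with one rate `m(β)` (pair-dependent constants, `n`-dependent thresholds), THEN the
  crux's conclusion (all `n ≤ S` on all tori `S ≥ S₀(A,B)`, `C(A,B)` and `S₀(A,B)` uniform in `β ≥ β₁`,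
  rate `m(β)`).  Why it might fail: infinite-volume decay (weak mixing) does not control separations
  `n ∈ (S₀⁻¹(S), S]` at all; the torus trace `Tr(T_S^{2S+1−n} Â T_Sⁿ B̂)/Tr T_S^{2S+1}` needs the gap of the
  SPATIAL-torus transfer matrix `T_S` uniformly in `S` plus an entropy bound on `Tr T_S^{t}` (thermal
  wrap-around on the hypercubic torus, `(2S+1)³ e^{−m(2S+1)} → 0` only for a theory with particle
  structure), and the `β`-uniform threshold needs `S₀(β, A, B)` to separate as `S₀(β) + R(A, B)` so that the
  femto regime is absorbed by shrinking `m(β)`.  Size L (M at strong coupling, where the cluster expansion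
  gives everything directly).
* `ThinEdgeExclusion_of` — the composition, a real proof: fix `G, r, β₀` and the super-polynomial
  hypothesis `hH`; apply (F) at `β₀`, feeding it, at each `β ≥ β₀`, the output of (E) at `β` on `hH β`.
  Registered form = the crux BY NAME with the stubs used by name inside the proof (what
  `ledger skeleton check` audits); `thinEdgeExclusion_of_stubs` right after it is the HYPOTHESIS FORM
  `<stub₁-sig> → <stub₂-sig> → ThinEdgeExclusion` with no reference to the stubs (sorry-free, axioms
  `propext`, `Classical.choice`, `Quot.sound`).

Neither stub is the crux or the summit in costume: `stub_finiteSizeBootstrap` has a strictly STRONGER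
antecedent than the crux (exponential, not super-polynomial, infinite-volume decay), `stub_edgeRegularity`
concludes an infinite-volume-form statement at one `β` (no volume uniformity, no `β`-uniformity); the cheap
probes `stub → ThinEdgeExclusion`, `stub → YangMills` fail for both (registrar folder `bc/`, `Lines/birth.md`).

## Disproof used

None exists for this crux at registration (`ledger crux ls stmt-QuantumFields-9706`: no workfiles; no
`Theorems/ThinEdgeExclusion/Negative/`); negatives index (5 entries, 2026-08-17) has no clustering-upgrade
statement.  Junk audit: trivial `G` / `β = 0` (independent Haar links) satisfy both stubs (no degenerate
refutation); U(1) at large `β` makes both antecedents false (vacuous there, as the route's Barriers section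
records for the crux itself).  Negative `β` (in range of both stubs) produces 't Hooft-twist frustration
on ODD tori for non-abelian `G`; this touches only finite-size statements at `β < 0`, which the free `∃ β₁` of
the conclusion of (F) / of the crux sidesteps, and not the infinite-volume-form statements of (E).

## BC3 audit (registrar folder `bc/`, 2026-08-17; full record in `Lines/birth.md`)

* this file: `lean check --json` rc 0, errors [], sorries 2 = stubs (`stub_edgeRegularity`,
  `stub_finiteSizeBootstrap`), zero elsewhere; `#print axioms thinEdgeExclusion_of_stubs` =
  [propext, Classical.choice, Quot.sound]; `#h21_check_skeleton` pretest: ok, theorem `ThinEdgeExclusion_of`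
  concludes `…InfraredLiouville.ThinEdgeExclusion` BY NAME, closed = false.
* probes (stub statements restated as local defs, stubs NOT in scope), prescribed battery
  `first | exact? | simpa | simpa [S] | (unfold S; simpa) | aesop` at 400000 heartbeats: 4/4 FAIL
  (E → crux, E → YangMills, F → crux, F → YangMills: deterministic timeouts at whnf/simp); per tactic with
  separate budgets: 12/12 FAIL (`exact?` "could not close the goal" ×4, `simpa` type mismatch ×4, `aesop`
  "failed to prove the goal after exhaustive search" ×4).
* extra: `StubE`, `StubF` not closed by `exact?`/`aesop`, `¬StubE`, `¬StubF` not closed by `exact?`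
  (imports: both route files naming this conclusion shape + six Literature transfer/clustering modules);
  converses `ThinEdgeExclusion → StubE/StubF` not cheap either (8/8 FAIL).

Namespace `Summit.QuantumFields.YangMills.Cruxes.ThinEdgeExclusion.Birth`.
-/

noncomputable section

namespace Summit.QuantumFields.YangMills.Cruxes.ThinEdgeExclusion.Birth

open Literature.MathematicalPhysics.QuantumFieldTheory
open Summit.QuantumFields.YangMills.Theses.InfraredLiouville

/-- **Stub (E) — edge regularity / thin-edge exclusion proper, pointwise in `β` (OPEN).**  At a fixed
coupling `β`, super-polynomial decay (infinite-volume form) of every connected torus time-correlation of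
gauge-invariant local observables forces EXPONENTIAL decay in the same infinite-volume form with ONE rate
`m > 0` for all pairs (pair-dependent constants, `n`-dependent volume thresholds). -/
theorem stub_edgeRegularity :
    open Literature.MathematicalPhysics.QuantumFieldTheory in
    ∀ (G : Type) [Group G] [TopologicalSpace G] [IsTopologicalGroup G] [CompactSpace G]
      [MeasurableSpace G] [BorelSpace G] (r : LatticeRep G) (β : ℝ),
      (∀ A B : YMSpecies G, ∀ p : ℕ, ∃ C : ℝ, ∀ n : ℕ, ∃ S₀ : ℕ, ∀ S : ℕ, S₀ ≤ S →
        (n : ℝ) ^ p * |latticeConnectedCorr r.ρ β (2 * S + 1) A.F B.F n| ≤ C) →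
      ∃ m : ℝ, 0 < m ∧ ∀ A B : YMSpecies G, ∃ C : ℝ, ∀ n : ℕ, ∃ S₀ : ℕ, ∀ S : ℕ, S₀ ≤ S →
        |latticeConnectedCorr r.ρ β (2 * S + 1) A.F B.F n| ≤ C * Real.exp (-(m * n)) := by
  sorry

/-- **Stub (F) — finite-size bootstrap with `β`-uniform prefactors (OPEN).**  If at every `β ≥ β₀` the
theory clusters exponentially in infinite-volume form with one rate `m(β) > 0`, then there are `β₁` and a
rate function `m` positive on `[β₁, ∞)` such that every pair `(A, B)` has constants `C, S₀` UNIFORM in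
`β ≥ β₁` with `|latticeConnectedCorr r.ρ β (2S+1) A B n| ≤ C e^{−m(β) n}` for all `S ≥ S₀` and ALL `n ≤ S`
— verbatim the conclusion of the crux. -/
theorem stub_finiteSizeBootstrap :
    open Literature.MathematicalPhysics.QuantumFieldTheory in
    ∀ (G : Type) [Group G] [TopologicalSpace G] [IsTopologicalGroup G] [CompactSpace G]
      [MeasurableSpace G] [BorelSpace G] (r : LatticeRep G) (β₀ : ℝ),
      (∀ β : ℝ, β₀ ≤ β → ∃ m : ℝ, 0 < m ∧ ∀ A B : YMSpecies G, ∃ C : ℝ, ∀ n : ℕ, ∃ S₀ : ℕ,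
        ∀ S : ℕ, S₀ ≤ S →
          |latticeConnectedCorr r.ρ β (2 * S + 1) A.F B.F n| ≤ C * Real.exp (-(m * n))) →
      ∃ (β₁ : ℝ) (m : ℝ → ℝ), (∀ β : ℝ, β₁ ≤ β → 0 < m β) ∧ ∀ A B : YMSpecies G,
        ∃ (C : ℝ) (S₀ : ℕ), ∀ β : ℝ, β₁ ≤ β → ∀ S : ℕ, S₀ ≤ S → ∀ n : ℕ, n ≤ S →
          |latticeConnectedCorr r.ρ β (2 * S + 1) A.F B.F n| ≤ C * Real.exp (-(m β * n)) := by
  sorry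

/-- **Composition (registered form)**: the two stubs BY NAME give the crux BY NAME — fix `G, r, β₀` and the
super-polynomial hypothesis; (F) at `β₀` applied to the family `β ↦ (E) at β`.  The only `sorry`s of this
file are the two stubs. -/
theorem ThinEdgeExclusion_of :
    Summit.QuantumFields.YangMills.Theses.InfraredLiouville.ThinEdgeExclusion := by
  intro G _ _ _ _ _ _ r β₀ hH
  exact stub_finiteSizeBootstrap G r β₀ fun β hβ => stub_edgeRegularity G r β (hH β hβ)

/-- **Hypothesis form (BC3): `<stub (E) sig> → <stub (F) sig> → ThinEdgeExclusion`**, verbatim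
signatures, NO reference to the stubs — a real, `sorry`-free proof (pure logic). -/
theorem thinEdgeExclusion_of_stubs
    (hE : ∀ (G : Type) [Group G] [TopologicalSpace G] [IsTopologicalGroup G] [CompactSpace G]
      [MeasurableSpace G] [BorelSpace G] (r : LatticeRep G) (β : ℝ),
      (∀ A B : YMSpecies G, ∀ p : ℕ, ∃ C : ℝ, ∀ n : ℕ, ∃ S₀ : ℕ, ∀ S : ℕ, S₀ ≤ S →
        (n : ℝ) ^ p * |latticeConnectedCorr r.ρ β (2 * S + 1) A.F B.F n| ≤ C) →
      ∃ m : ℝ, 0 < m ∧ ∀ A B : YMSpecies G, ∃ C : ℝ, ∀ n : ℕ, ∃ S₀ : ℕ, ∀ S : ℕ, S₀ ≤ S →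
        |latticeConnectedCorr r.ρ β (2 * S + 1) A.F B.F n| ≤ C * Real.exp (-(m * n)))
    (hF : ∀ (G : Type) [Group G] [TopologicalSpace G] [IsTopologicalGroup G] [CompactSpace G]
      [MeasurableSpace G] [BorelSpace G] (r : LatticeRep G) (β₀ : ℝ),
      (∀ β : ℝ, β₀ ≤ β → ∃ m : ℝ, 0 < m ∧ ∀ A B : YMSpecies G, ∃ C : ℝ, ∀ n : ℕ, ∃ S₀ : ℕ,
        ∀ S : ℕ, S₀ ≤ S →
          |latticeConnectedCorr r.ρ β (2 * S + 1) A.F B.F n| ≤ C * Real.exp (-(m * n))) →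
      ∃ (β₁ : ℝ) (m : ℝ → ℝ), (∀ β : ℝ, β₁ ≤ β → 0 < m β) ∧ ∀ A B : YMSpecies G,
        ∃ (C : ℝ) (S₀ : ℕ), ∀ β : ℝ, β₁ ≤ β → ∀ S : ℕ, S₀ ≤ S → ∀ n : ℕ, n ≤ S →
          |latticeConnectedCorr r.ρ β (2 * S + 1) A.F B.F n| ≤ C * Real.exp (-(m β * n))) :
    Summit.QuantumFields.YangMills.Theses.InfraredLiouville.ThinEdgeExclusion := by
  intro G _ _ _ _ _ _ r β₀ hH
  exact hF G r β₀ fun β hβ => hE G r β (hH β hβ)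

/-- Signature match (kernel-checked): the stubs instantiate the hypothesis form, and the result is the
registered composition's statement. -/
example : Summit.QuantumFields.YangMills.Theses.InfraredLiouville.ThinEdgeExclusion :=
  thinEdgeExclusion_of_stubs stub_edgeRegularity stub_finiteSizeBootstrap

#print axioms thinEdgeExclusion_of_stubs

end Summit.QuantumFields.YangMills.Cruxes.ThinEdgeExclusion.Birth

end
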